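import Summits.QuantumFields.YangMills.Theorems.ForcedResponseSkewnessResponseLocalisationFarCluster
import Summits.QuantumFields.YangMills.Theorems.ForcedResponseSkewnessResponseLocalisationFarStubSep
import HarnessLib

/-!
# Crux `ResponseLocalisation` (stmt-QuantumFields-24293), far stub `Repair.stub_far : FarSigR`:
# the triangle majorant on CHARGED far triples from «collar first, cluster second»

Support file (`--supports stmt-QuantumFields-24293 --as helper`) of the width prover `ym-line-frs-p2` (lead `ym-line-frs-p1`), route
`ForcedResponseSkewness`; sequel of `…FarCluster` (`abs_torusK3_le_of_collar_cluster`).  For a triple charged by the far-field sum —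
`x ∈ box L` far (`‖s x‖ > D`), `y` under the reflected source (`‖s y‖ ≤ R₀`, `(s y)₀ ≤ −g`), `z` under the source (`‖s z‖ ≤ R₀`,
`g ≤ (s z)₀`) — at spacing `s ∈ [aβ, Λ·aβ]`, `s ≤ 1`, with collar radius `R ≍ r/s` (`r` a fixed physical scale below the wall gap and the
femto scale), the bound `K(2C₁/R⁴)³e^{−m·aβ·n}` of `…FarCluster` (femto boundary law at `β` + clustering inequality at `(β, L)`, the
latter a gap-class HYPOTHESIS) is dominated by the scale-free triangle majorant `A·(1+d_T(x,y))⁻⁴(1+d_T(x,z))⁻⁴(1+d_T(y,z))⁻⁴` of the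
landed far-field bookkeeping (`…FarSmear.far_sum_abs_smear_le`) with ONE constant
`A = K(2C₁)³(2/r)¹²e^{m(R₀+2r+4)/Λ}(1+2R₀)⁴(1+R₀)⁸2⁸(1+8!/μ⁸)`, `μ = m/(2Λ)`, independent of `s`, `L`, `β`:
`abs_torusK3_le_triangle_charged`.  §1: two real-variable lemmas (`t⁸e^{−μt} ≤ 8!/μ⁸`) and the sup-coordinate of an integer site.

Honest label: bookkeeping toward ONE stub of a CONDITIONAL rung line (leaf R2a `BalabanLadder.NT`) under an IR (gap-class) hypothesis; no stub,
crux, NT or Yang–Mills mass-gap claim is proved here.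
-/

set_option autoImplicit false

noncomputable section

open MeasureTheory Filter Topology
open Literature.MathematicalPhysics.QuantumFieldTheory Literature.MathematicalPhysics.QuantumLattice
open Literature.Probability.LatticeModels
open Summit.QuantumFields.YangMills.Cruxes.OSLegsFromFemtoAndGap.DlrCollarTransfer
open Summit.QuantumFields.YangMills.Cruxes.RunningCouplingCeiling.Pointwise

namespace Summit.QuantumFields.YangMills.Cruxes.ResponseLocalisation.Far

/-! ## §1 Real-variable and lattice-geometry helpers -/

/-- `t⁸ e^{−μt} ≤ 8!/μ⁸` for `μ > 0`, `t ≥ 0` (from `(μt)⁸/8! ≤ e^{μt}`). [folklore] -/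
theorem pow_eight_mul_exp_neg_le {μ t : ℝ} (hμ : 0 < μ) (ht : 0 ≤ t) :
    t ^ 8 * Real.exp (-(μ * t)) ≤ 40320 / μ ^ 8 := by
  have h := Real.pow_div_factorial_le_exp (x := μ * t) (by positivity) 8
  have h8 : ((Nat.factorial 8 : ℕ) : ℝ) = 40320 := by norm_num [Nat.factorial]
  rw [h8, div_le_iff₀ (by norm_num : (0 : ℝ) < 40320)] at h
  have hexp : 0 < Real.exp (μ * t) := Real.exp_pos _
  rw [Real.exp_neg, le_div_iff₀ (by positivity)]
  have hμ8 : 0 < μ ^ 8 := by positivity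
  calc t ^ 8 * (Real.exp (μ * t))⁻¹ * μ ^ 8 = (μ * t) ^ 8 / Real.exp (μ * t) := by
        rw [div_eq_mul_inv]; ring
    _ ≤ Real.exp (μ * t) * 40320 / Real.exp (μ * t) := by gcongr
    _ = 40320 := by field_simp

/-- `(1 + t)⁸ e^{−μt} ≤ 2⁸ (1 + 8!/μ⁸)` for `μ > 0`, `t ≥ 0`. [folklore] -/
theorem one_add_pow_eight_mul_exp_neg_le {μ t : ℝ} (hμ : 0 < μ) (ht : 0 ≤ t) :
    (1 + t) ^ 8 * Real.exp (-(μ * t)) ≤ 2 ^ 8 * (1 + 40320 / μ ^ 8) := by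
  have hexp1 : Real.exp (-(μ * t)) ≤ 1 := by
    rw [Real.exp_le_one_iff]; nlinarith
  have hexp0 : 0 < Real.exp (-(μ * t)) := Real.exp_pos _
  have hpow : (1 + t) ^ 8 ≤ 2 ^ 8 * (1 + t ^ 8) := by
    rcases le_total t 1 with h | h
    · calc (1 + t) ^ 8 ≤ 2 ^ 8 := pow_le_pow_left₀ (by positivity) (by linarith) 8
        _ ≤ 2 ^ 8 * (1 + t ^ 8) := by
            have : 0 ≤ t ^ 8 := by positivity
            nlinarith
    · calc (1 + t) ^ 8 ≤ (2 * t) ^ 8 := pow_le_pow_left₀ (by positivity) (by linarith) 8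
        _ = 2 ^ 8 * t ^ 8 := by ring
        _ ≤ 2 ^ 8 * (1 + t ^ 8) := by nlinarith
  have h8 := pow_eight_mul_exp_neg_le hμ ht
  calc (1 + t) ^ 8 * Real.exp (-(μ * t)) ≤ 2 ^ 8 * (1 + t ^ 8) * Real.exp (-(μ * t)) :=
        mul_le_mul_of_nonneg_right hpow hexp0.le
    _ = 2 ^ 8 * (Real.exp (-(μ * t)) + t ^ 8 * Real.exp (-(μ * t))) := by ring
    _ ≤ 2 ^ 8 * (1 + 40320 / μ ^ 8) := by gcongr

/-- **Sup coordinate of an integer site**: some coordinate `k` has `|x_j| ≤ |x_k|` for all `j` and `‖x‖ ≤ 2|x_k|`. [folklore] -/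
theorem exists_sup_coord_norm_le (x : Site 4) :
    ∃ k : Fin 4, (∀ j, |x j| ≤ |x k|) ∧ ‖siteToE x‖ ≤ 2 * |(x k : ℝ)| := by
  classical
  obtain ⟨k, -, hk⟩ := Finset.exists_max_image (Finset.univ : Finset (Fin 4)) (fun j => |x j|) Finset.univ_nonempty
  have hk' : ∀ j, |x j| ≤ |x k| := fun j => hk j (Finset.mem_univ _)
  refine ⟨k, hk', ?_⟩
  have hsq : ‖siteToE x‖ ^ 2 ≤ (2 * |(x k : ℝ)|) ^ 2 := by
    rw [EuclideanSpace.norm_eq, Real.sq_sqrt (Finset.sum_nonneg fun _ _ => sq_nonneg _)]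
    calc ∑ j : Fin 4, ‖(siteToE x) j‖ ^ 2 ≤ ∑ _j : Fin 4, |(x k : ℝ)| ^ 2 := by
          refine Finset.sum_le_sum fun j _ => ?_
          have hj : ‖(siteToE x) j‖ = |(x j : ℝ)| := by simp [Real.norm_eq_abs]
          rw [hj]
          have : |(x j : ℝ)| ≤ |(x k : ℝ)| := by exact_mod_cast hk' j
          exact pow_le_pow_left₀ (abs_nonneg _) this 2
      _ = (2 * |(x k : ℝ)|) ^ 2 := by
          rw [Finset.sum_const, Finset.card_univ, Fintype.card_fin, nsmul_eq_mul]; push_cast; ring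
  exact (pow_le_pow_iff_left₀ (norm_nonneg _) (by positivity) two_ne_zero).mp hsq

/-- A coordinate of a scaled site is bounded by its norm: `s|w_j| ≤ ‖s w‖` (`s ≥ 0`). [folklore] -/
theorem mul_abs_coord_le_norm {s : ℝ} (hs : 0 ≤ s) (w : Site 4) (j : Fin 4) :
    s * |(w j : ℝ)| ≤ ‖s • siteToE w‖ := by
  calc s * |(w j : ℝ)| = ‖(s • siteToE w) j‖ := by simp [Real.norm_eq_abs, abs_of_nonneg hs]
    _ ≤ ‖s • siteToE w‖ := PiLp.norm_apply_le _ j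

/-! ## §2 The triangle majorant on charged far triples -/

section Charged

variable (G : Type) [Group G] [TopologicalSpace G] [IsTopologicalGroup G] [CompactSpace G]
  [MeasurableSpace G] [BorelSpace G] (r : LatticeRep G)

/-- **Triangle majorant on a charged far triple from the collar–cluster bound.**  Data: the femto boundary law for the action density at
`β` (constants `C₁, ℓ₁, p`, cubes of side `b·aβ ≤ ℓ₁`), a clustering inequality at `(β, L)` with rate `m·aβ` and constant `K` (HYPOTHESIS,
gap-class), a spacing `0 < s ≤ 1` with `s ≤ Λ·aβ`, a collar radius `R ≥ 1` with `r ≤ 2sR`, `sR ≤ r`, `(2R+3)·aβ ≤ ℓ₁`, `4R+8 ≤ L`,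
`s(2R+4) ≤ g`, a source radius `R₀ ≥ 0` with `2R₀ ≤ sL`, and the far threshold `D ≥ 2R₀ + 4r + 8`.  Then for `x ∈ box L` with
`‖s x‖ > D`, `y` with `‖s y‖ ≤ R₀`, `(s y)₀ ≤ −g` and `z` with `‖s z‖ ≤ R₀`, `g ≤ (s z)₀`:
`|torusK3_{β,L}(x,y,z)| ≤ A · (1+d_T(x,y))⁻⁴(1+d_T(x,z))⁻⁴(1+d_T(y,z))⁻⁴` with the constant `A` displayed in the statement
(independent of `s`, `L`, `β`). [folklore] -/
theorem abs_torusK3_le_triangle_charged (β : ℝ) {aβ C₁ ℓ₁ p : ℝ} (hC₁ : 0 ≤ C₁)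
    (hF : ∀ (c : Fin 4 → ℤ) (b : ℕ), (b : ℝ) * aβ ≤ ℓ₁ → ∀ (η : LGConfig 4 G) (w : Fin 4 → ℤ),
      2 ≤ depth c b w → |kerE G r β c b η (dens G r w) - p| ≤ C₁ / (depth c b w : ℝ) ^ 4)
    {L R : ℕ} (hR : 1 ≤ R) (hb : ((2 * R + 3 : ℕ) : ℝ) * aβ ≤ ℓ₁) (hRL : 4 * R + 8 ≤ L)
    {m K : ℝ} (hm : 0 < m) (hK : 0 ≤ K)
    (hCl : ∀ (P Q : LGConfig 4 G → ℝ) (SP SQ : Finset (Literature.MathematicalPhysics.QuantumLattice.ZdEdge 4))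
      (CP CQ : ℝ), Continuous P → Continuous Q → IsCylinder P SP → IsCylinder Q SQ →
      (∀ U, |P U| ≤ CP) → (∀ U, |Q U| ≤ CQ) → ∀ (k : Fin 4) (n : ℕ),
      (∀ e ∈ SP, ∀ e' ∈ SQ, (n : ℤ) ≤ |((((e.1 k - e'.1 k : ℤ) : ZMod (2 * L + 1))).valMinAbs : ℤ)|) →
      |torusE G r β L (fun U => P U * Q U) - torusE G r β L P * torusE G r β L Q| ≤
        K * CP * CQ * Real.exp (-(m * aβ * n)))
    {s rr R₀ g Λ D : ℝ} (hs : 0 < s) (hs1 : s ≤ 1) (hΛ : 1 ≤ Λ) (hsΛ : s ≤ Λ * aβ)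
    (hr : 0 < rr) (hrR : rr ≤ 2 * s * R) (hRr : s * R ≤ rr) (hR₀ : 0 ≤ R₀)
    (hRg : s * (2 * R + 4) ≤ g) (hD : 2 * R₀ + 4 * rr + 8 ≤ D) (hL : 2 * R₀ ≤ s * L)
    {x y z : Fin 4 → ℤ} (hx : x ∈ box 4 L) (hxD : D < ‖s • siteToE x‖)
    (hyR : ‖s • siteToE y‖ ≤ R₀) (hyt : (s • siteToE y) 0 ≤ -g)
    (hzR : ‖s • siteToE z‖ ≤ R₀) (hzt : g ≤ (s • siteToE z) 0) :
    |torusK3 G r β L x y z| ≤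
      (K * (2 * C₁) ^ 3 * (2 / rr) ^ 12 * Real.exp (m * (R₀ + 2 * rr + 4) / Λ) * (1 + 2 * R₀) ^ 4 *
          ((1 + R₀) ^ 8 * (2 ^ 8 * (1 + 40320 / (m / (2 * Λ)) ^ 8)))) *
        (((1 + torusDist L x y) ^ 4)⁻¹ * ((1 + torusDist L x z) ^ 4)⁻¹ * ((1 + torusDist L y z) ^ 4)⁻¹) := by
  -- coordinates of scaled sites
  have e0 : ∀ w : Site 4, (s • siteToE w) 0 = s * (w 0 : ℝ) := fun w => by simp
  have hsx : ‖s • siteToE x‖ = s * ‖siteToE x‖ := norm_smul_siteToE hs.le x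
  have hsy : ‖s • siteToE y‖ = s * ‖siteToE y‖ := norm_smul_siteToE hs.le y
  have hsz : ‖s • siteToE z‖ = s * ‖siteToE z‖ := norm_smul_siteToE hs.le z
  set t : ℝ := ‖s • siteToE x‖ with ht
  have ht0 : 0 ≤ t := norm_nonneg _
  have hD0 : 0 ≤ D := by linarith
  -- integer coordinate bounds of the near sites
  have hyk : ∀ j, s * |(y j : ℝ)| ≤ R₀ := fun j => (mul_abs_coord_le_norm hs.le y j).trans hyR
  have hzk : ∀ j, s * |(z j : ℝ)| ≤ R₀ := fun j => (mul_abs_coord_le_norm hs.le z j).trans hzR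
  have hxL : ∀ j, |x j| ≤ (L : ℤ) := fun j => by
    rw [mem_box] at hx; exact abs_le.mpr ⟨(hx j).1, (hx j).2⟩
  -- the sup coordinate of the far site
  obtain ⟨k, -, hk⟩ := exists_sup_coord_norm_le x
  have hxk : t / 2 ≤ s * |(x k : ℝ)| := by
    have := mul_le_mul_of_nonneg_left hk hs.le
    linarith
  -- the separation integer `n` in coordinate `k`
  set My : ℤ := max |y k| |z k| with hMy
  have hMyR : s * (My : ℝ) ≤ R₀ := by
    rcases le_total |y k| |z k| with h | h
    · rw [hMy, max_eq_right h]; push_cast; exact hzk k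
    · rw [hMy, max_eq_left h]; push_cast; exact hyk k
  have hsR2 : s * (2 * (R : ℝ) + 4) ≤ 2 * rr + 4 := by
    have e : s * (2 * (R : ℝ) + 4) = 2 * (s * R) + 4 * s := by ring
    rw [e]; linarith
  -- the separation integer `N = |x_k| − My − 2R − 4 ≥ 0`
  set NZ : ℤ := |x k| - My - 2 * (R : ℤ) - 4 with hNZ
  have hNZcast : ((NZ : ℤ) : ℝ) = |(x k : ℝ)| - (My : ℝ) - 2 * (R : ℝ) - 4 := by
    rw [hNZ]; push_cast; ring
  have hNlow : t / 2 - R₀ - (2 * rr + 4) ≤ s * (|(x k : ℝ)| - (My : ℝ) - 2 * (R : ℝ) - 4) := by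
    have e : s * (|(x k : ℝ)| - (My : ℝ) - 2 * (R : ℝ) - 4) = s * |(x k : ℝ)| - s * My - s * (2 * R + 4) := by
      ring
    rw [e]; linarith
  have hNreal : 0 ≤ |(x k : ℝ)| - (My : ℝ) - 2 * (R : ℝ) - 4 := by
    have h2 : 0 ≤ s * (|(x k : ℝ)| - (My : ℝ) - 2 * (R : ℝ) - 4) := by linarith
    exact (mul_nonneg_iff_of_pos_left hs).mp h2
  have hNint : 0 ≤ NZ := by
    have : (0 : ℝ) ≤ ((NZ : ℤ) : ℝ) := by rw [hNZcast]; exact hNreal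
    exact_mod_cast this
  set n : ℕ := NZ.toNat with hn
  have hncast : (n : ℤ) = NZ := by rw [hn]; exact Int.toNat_of_nonneg hNint
  have hnreal : (n : ℝ) = |(x k : ℝ)| - (My : ℝ) - 2 * (R : ℝ) - 4 := by
    rw [← hNZcast]; exact_mod_cast hncast
  -- separations in coordinate `k`
  have hnxy : (n : ℤ) + 2 * R + 4 ≤ |((((x k - y k : ℤ) : ZMod (2 * L + 1))).valMinAbs : ℤ)| := by
    have h1 := abs_sub_abs_le_abs_valMinAbs L (y k) (hxL k)
    have h2 : |y k| ≤ My := le_max_left _ _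
    rw [hncast, hNZ]; linarith
  have hnxz : (n : ℤ) + 2 * R + 4 ≤ |((((x k - z k : ℤ) : ZMod (2 * L + 1))).valMinAbs : ℤ)| := by
    have h1 := abs_sub_abs_le_abs_valMinAbs L (z k) (hxL k)
    have h2 : |z k| ≤ My := le_max_right _ _
    rw [hncast, hNZ]; linarith
  have hxy : ∃ j : Fin 4, (2 * (R : ℤ) + 4) ≤ |((((x j - y j : ℤ) : ZMod (2 * L + 1))).valMinAbs : ℤ)| :=
    ⟨k, by linarith [hnxy]⟩
  have hxz : ∃ j : Fin 4, (2 * (R : ℤ) + 4) ≤ |((((x j - z j : ℤ) : ZMod (2 * L + 1))).valMinAbs : ℤ)| :=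
    ⟨k, by linarith [hnxz]⟩
  -- y–z separation in the time coordinate (no wrap-around: `|y₀ − z₀| ≤ 2R₀/s ≤ L`)
  have hyz : ∃ j : Fin 4, (2 * (R : ℤ) + 4) ≤ |((((y j - z j : ℤ) : ZMod (2 * L + 1))).valMinAbs : ℤ)| := by
    refine ⟨0, ?_⟩
    have ht1 : s * (y 0 : ℝ) ≤ -g := by rw [← e0]; exact hyt
    have ht2 : g ≤ s * (z 0 : ℝ) := by rw [← e0]; exact hzt
    have hy0 : s * |(y 0 : ℝ)| ≤ R₀ := hyk 0
    have hz0 : s * |(z 0 : ℝ)| ≤ R₀ := hzk 0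
    -- real size of the gap and of the coordinates
    have hgapR : s * (2 * (R : ℝ) + 4) ≤ s * (((z 0 : ℝ)) - y 0) := by
      have e : s * (((z 0 : ℝ)) - y 0) = s * (z 0 : ℝ) - s * (y 0 : ℝ) := by ring
      rw [e]; linarith
    have hgap : 2 * (R : ℝ) + 4 ≤ (z 0 : ℝ) - y 0 := le_of_mul_le_mul_left hgapR hs
    have habsR : s * |((y 0 : ℝ)) - z 0| ≤ s * L := by
      calc s * |((y 0 : ℝ)) - z 0| ≤ s * (|(y 0 : ℝ)| + |(z 0 : ℝ)|) :=
            mul_le_mul_of_nonneg_left (abs_sub _ _) hs.le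
        _ ≤ R₀ + R₀ := by linarith
        _ ≤ s * L := by linarith
    have habs : |((y 0 : ℝ)) - z 0| ≤ L := le_of_mul_le_mul_left habsR hs
    have habsZ : |y 0 - z 0| ≤ (L : ℤ) := by exact_mod_cast habs
    have h1 := abs_sub_abs_le_abs_valMinAbs L (0 : ℤ) habsZ
    simp only [abs_zero, sub_zero] at h1
    have hgapZ : 2 * (R : ℤ) + 4 ≤ |y 0 - z 0| := by
      have : (2 * (R : ℝ) + 4) ≤ |((y 0 : ℝ)) - z 0| := by
        rw [abs_sub_comm]; exact hgap.trans (le_abs_self _)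
      exact_mod_cast this
    exact hgapZ.trans h1
  -- collar first, cluster second
  have hmain := abs_torusK3_le_of_collar_cluster G r β hC₁ hF hR hb hRL hCl x y z hxy hxz hyz k n hnxy hnxz
  -- the decay exponent: `m·aβ·n ≥ (m/Λ)(t/2 − c)`, `c = R₀ + 2r + 4`
  have hn_lower : t / 2 - (R₀ + 2 * rr + 4) ≤ s * (n : ℝ) := by
    rw [hnreal]
    linarith [hNlow]
  have hexp : Real.exp (-(m * aβ * n)) ≤
      Real.exp (m * (R₀ + 2 * rr + 4) / Λ) * Real.exp (-(m / (2 * Λ) * t)) := by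
    rw [← Real.exp_add, Real.exp_le_exp]
    have hΛ0 : 0 < Λ := by linarith
    have haΛ : s / Λ ≤ aβ := by rw [div_le_iff₀ hΛ0]; linarith
    -- `m aβ n ≥ m (s/Λ) n ≥ (m/Λ)(t/2 − c)`
    have h1 : m * (s / Λ) * n ≤ m * aβ * n := by
      have hn0 : (0 : ℝ) ≤ n := Nat.cast_nonneg n
      have h3 := mul_le_mul_of_nonneg_left (mul_le_mul_of_nonneg_right haΛ hn0) hm.le
      calc m * (s / Λ) * n = m * (s / Λ * n) := by ring
        _ ≤ m * (aβ * n) := h3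
        _ = m * aβ * n := by ring
    have h2 : m / Λ * (t / 2 - (R₀ + 2 * rr + 4)) ≤ m * (s / Λ) * n := by
      have := mul_le_mul_of_nonneg_left hn_lower (div_nonneg hm.le hΛ0.le)
      calc m / Λ * (t / 2 - (R₀ + 2 * rr + 4)) ≤ m / Λ * (s * n) := this
        _ = m * (s / Λ) * n := by ring
    have e : m * (R₀ + 2 * rr + 4) / Λ + -(m / (2 * Λ) * t) = -(m / Λ * (t / 2 - (R₀ + 2 * rr + 4))) := by
      field_simp; ring
    rw [e]; linarith
  -- the collar constant: `(2C₁/R⁴)³ ≤ (2C₁)³ (2s/r)¹²`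
  have hRpos : (0 : ℝ) < R := by exact_mod_cast hR
  have hRinv : ((R : ℝ))⁻¹ ≤ 2 * s / rr := by
    rw [inv_eq_one_div, div_le_div_iff₀ hRpos hr]; linarith
  have hε : (2 * C₁ / (R : ℝ) ^ 4) ^ 3 ≤ (2 * C₁) ^ 3 * ((2 / rr) ^ 12 * s ^ 12) := by
    have h1 : (2 * C₁ / (R : ℝ) ^ 4) ^ 3 = (2 * C₁) ^ 3 * (((R : ℝ))⁻¹) ^ 12 := by
      rw [div_eq_mul_inv, mul_pow, ← inv_pow, ← pow_mul]
    rw [h1]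
    refine mul_le_mul_of_nonneg_left ?_ (by positivity)
    calc (((R : ℝ))⁻¹) ^ 12 ≤ (2 * s / rr) ^ 12 := pow_le_pow_left₀ (by positivity) hRinv 12
      _ = (2 / rr) ^ 12 * s ^ 12 := by rw [← mul_pow]; ring
  -- the triangle factors from below: `(1 + d)⁻⁴ ≥ (s/(1 + t + R₀))⁴` for the x-legs, `(s/(1+2R₀))⁴` for the y–z leg
  have hdxy : torusDist L x y ≤ (t + R₀) / s := by
    have h3 := mul_le_mul_of_nonneg_left ((torusDist_le_norm_sub L x y).trans (norm_sub_le _ _)) hs.le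
    rw [le_div_iff₀ hs, mul_comm]
    rw [mul_add] at h3
    linarith [hsx, hsy]
  have hdxz : torusDist L x z ≤ (t + R₀) / s := by
    have h3 := mul_le_mul_of_nonneg_left ((torusDist_le_norm_sub L x z).trans (norm_sub_le _ _)) hs.le
    rw [le_div_iff₀ hs, mul_comm]
    rw [mul_add] at h3
    linarith [hsx, hsz]
  have hdyz : torusDist L y z ≤ 2 * R₀ / s := by
    have h3 := mul_le_mul_of_nonneg_left ((torusDist_le_norm_sub L y z).trans (norm_sub_le _ _)) hs.le
    rw [le_div_iff₀ hs, mul_comm]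
    rw [mul_add] at h3
    linarith [hsy, hsz]
  have hleg : ∀ {d B : ℝ}, 0 ≤ d → 0 ≤ B → d ≤ B / s → (s / (1 + B)) ^ 4 ≤ ((1 + d) ^ 4)⁻¹ := by
    intro d B hd hB hdB
    rw [← one_div, div_pow, div_le_div_iff₀ (by positivity) (by positivity), one_mul]
    have h1 : s * (1 + d) ≤ 1 + B := by
      have : s * d ≤ B := by rwa [le_div_iff₀ hs, mul_comm] at hdB
      have e : s * (1 + d) = s + s * d := by ring
      rw [e]; linarith
    calc s ^ 4 * (1 + d) ^ 4 = (s * (1 + d)) ^ 4 := by ring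
      _ ≤ (1 + B) ^ 4 := pow_le_pow_left₀ (by positivity) h1 4
  have htri : (s / (1 + (t + R₀))) ^ 4 * (s / (1 + (t + R₀))) ^ 4 * (s / (1 + 2 * R₀)) ^ 4 ≤
      ((1 + torusDist L x y) ^ 4)⁻¹ * ((1 + torusDist L x z) ^ 4)⁻¹ * ((1 + torusDist L y z) ^ 4)⁻¹ := by
    refine mul_le_mul (mul_le_mul (hleg (torusDist_nonneg L x y) (by positivity) hdxy)
      (hleg (torusDist_nonneg L x z) (by positivity) hdxz) (by positivity) (by positivity))
      (hleg (torusDist_nonneg L y z) (by positivity) hdyz) (by positivity) (by positivity)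
  -- the exponential against the polynomial weight
  have hpoly : Real.exp (-(m / (2 * Λ) * t)) ≤
      (1 + R₀) ^ 8 * (2 ^ 8 * (1 + 40320 / (m / (2 * Λ)) ^ 8)) * ((1 + (t + R₀)) ^ 8)⁻¹ := by
    have hμ : 0 < m / (2 * Λ) := by positivity
    have h1 := one_add_pow_eight_mul_exp_neg_le hμ ht0
    have h2 : (1 + (t + R₀)) ^ 8 ≤ (1 + R₀) ^ 8 * (1 + t) ^ 8 := by
      rw [← mul_pow]
      refine pow_le_pow_left₀ (by positivity) ?_ 8
      have e : (1 + R₀) * (1 + t) = 1 + (t + R₀) + R₀ * t := by ring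
      rw [e]; linarith [mul_nonneg hR₀ ht0]
    rw [← div_eq_mul_inv, le_div_iff₀ (by positivity)]
    calc Real.exp (-(m / (2 * Λ) * t)) * (1 + (t + R₀)) ^ 8
        ≤ Real.exp (-(m / (2 * Λ) * t)) * ((1 + R₀) ^ 8 * (1 + t) ^ 8) :=
          mul_le_mul_of_nonneg_left h2 (Real.exp_pos _).le
      _ = (1 + R₀) ^ 8 * ((1 + t) ^ 8 * Real.exp (-(m / (2 * Λ) * t))) := by ring
      _ ≤ (1 + R₀) ^ 8 * (2 ^ 8 * (1 + 40320 / (m / (2 * Λ)) ^ 8)) :=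
          mul_le_mul_of_nonneg_left h1 (by positivity)
  -- assemble
  set B : ℝ := (1 + R₀) ^ 8 * (2 ^ 8 * (1 + 40320 / (m / (2 * Λ)) ^ 8)) with hB
  have hB0 : 0 ≤ B := by positivity
  calc |torusK3 G r β L x y z| ≤ K * (2 * C₁ / (R : ℝ) ^ 4) ^ 3 * Real.exp (-(m * aβ * n)) := hmain
    _ ≤ K * ((2 * C₁) ^ 3 * ((2 / rr) ^ 12 * s ^ 12)) * (Real.exp (m * (R₀ + 2 * rr + 4) / Λ) * Real.exp (-(m / (2 * Λ) * t))) :=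
        mul_le_mul (mul_le_mul_of_nonneg_left hε hK) hexp (Real.exp_pos _).le (by positivity)
    _ ≤ K * ((2 * C₁) ^ 3 * ((2 / rr) ^ 12 * s ^ 12)) * (Real.exp (m * (R₀ + 2 * rr + 4) / Λ) * (B * ((1 + (t + R₀)) ^ 8)⁻¹)) := by
        gcongr
    _ = (K * (2 * C₁) ^ 3 * (2 / rr) ^ 12 * Real.exp (m * (R₀ + 2 * rr + 4) / Λ) * (1 + 2 * R₀) ^ 4 * B) *
          ((s / (1 + (t + R₀))) ^ 4 * (s / (1 + (t + R₀))) ^ 4 * (s / (1 + 2 * R₀)) ^ 4) := by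
        have h1 : (1 + 2 * R₀) ≠ 0 := by positivity
        have h2 : (1 + (t + R₀)) ≠ 0 := by positivity
        have h3 : rr ≠ 0 := hr.ne'
        field_simp
    _ ≤ (K * (2 * C₁) ^ 3 * (2 / rr) ^ 12 * Real.exp (m * (R₀ + 2 * rr + 4) / Λ) * (1 + 2 * R₀) ^ 4 * B) *
          (((1 + torusDist L x y) ^ 4)⁻¹ * ((1 + torusDist L x z) ^ 4)⁻¹ * ((1 + torusDist L y z) ^ 4)⁻¹) :=
        mul_le_mul_of_nonneg_left htri (by positivity)

end Charged

end Summit.QuantumFields.YangMills.Cruxes.ResponseLocalisation.Far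

end
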